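import Summits.ValiantsHypothesis.ValiantsHypothesis.Theorems.LacunarySymmetroidMatrixDescartesCensusPivotIndexRoots

/-!
# `MatrixDescartes` census — pivot column, INDEX ONE, EVERY SIZE `m`: at a positive determinant root the pencil is PSD,
# and the crossing parameter is unique (the index-one pivot law is a statement about ONE scalar function of `u`)

HONEST FRAMING.  Object-search cell `pub-symmetroid`, Conjecture-B column in PIVOT currency (`…CensusPivotDefs.lean`, seat conjb-1),
seat `val-sym-mdr-p1` (generation 7).  Helper file landed `--supports` the crux item stmt-ValiantsHypothesis-18050
(`Theses.LacunarySymmetroid.MatrixDescartes`, OPEN, on HOLD) with NO closure claim.  It extends the `m = 2` facts of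
`…CensusPivotIndexRoots` (g6: every positive root of an index-`≤ 1` `2 × 2` pivot pencil is a PSD root) and of
`…CensusPivotTwoEnvelope` (this seat: the `2 × 2` scalar envelope) to EVERY size `m`, for a NON-DEGENERATE pivot letter `J` of
index one (`J` symmetric, `det J ≠ 0`, `J + W Wᵀ ⪰ 0` for a single column `W`) and PSD letters `Pₖ`:

* `indexOne_pairing_sq_ge` (the index-one reverse Cauchy–Schwarz): `xᵀJx < 0 ⇒ (xᵀJx)(yᵀJy) ≤ (xᵀJy)²`
  (two `J`-negative vectors are never `J`-orthogonal).
* `kernel_quadForm_neg`: a kernel vector `v` of `A + λJ` (`A ⪰ 0`, `lam > 0`) has `vᵀJv < 0`.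
* **`posSemidef_of_det_eq_zero`**: `A ⪰ 0`, `lam > 0`, `det (A + λJ) = 0 ⇒ A + λJ ⪰ 0` (a `2 × 2` determinant argument on
  `span(v, x)`; no spectral theory).
* **`crossing_unique`**: `det (A + lam₁J) = det (A + lam₂J) = 0` with `lam₁, lam₂ > 0 ⇒ lam₁ = lam₂`.
* For the pencil `F(u) = u^e J + ∑ₖ u^{dₖ} Pₖ`: **`posSemidef_at_posRoot`** (every positive determinant root is a PSD root, every `m`),
  `crossing_unique_pencil` (for each `u > 0` at most one `lam > 0` has `det (∑ u^{dₖ}Pₖ + λJ) = 0`, and `u` is a root iff `lam = u^e` is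
  it), and the ENVELOPE BOUND `pow_mul_le_quadForm_of_isRoot`: at a root, `u^e · (−xᵀJx) ≤ ∑ₖ u^{dₖ} xᵀPₖx` for every `x` — `u^e` lies
  below every member of the family of `K`-nomials with non-negative coefficients `xᵀPₖx / (−xᵀJx)` indexed by the `J`-negative
  vectors `x` (for `J ≅ diag(−1, 1, …, 1)`: by the points of hyperbolic `(m−1)`-space).

So at index one the number `Z₊` of positive roots is, for every `m`, the number of solutions of ONE scalar equation `u^e = lam₊(A(u))`,
`lam₊ = inf` of that posynomial family (attained at the kernel vector) — the `m`-general form of the `m = 2` scalar envelope.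
Nothing here bears on `Theses.LacunarySymmetroid.MatrixDescartes` in its window, on `KPlusLogSqLaw`, on `DoorA26` / `DoorA34`,
on the cell's registers or credences, or on `VP ≠ VNP`.

[folklore] Elementary linear algebra (`Matrix.PosSemidef` API, `Matrix.exists_mulVec_eq_zero_iff`).  No definitions, no named facts.
-/

-- `Summit.ValiantsHypothesis.ValiantsHypothesis.…` repeats a component by the D-0017 layout
-- (single-conjunct summit), which the `dupNamespace` linter flags; the name is mandated.
set_option linter.dupNamespace false

namespace Summit.ValiantsHypothesis.ValiantsHypothesis.Theorems.LacunarySymmetroidMatrixDescartes.Pivot.IndexOneRoots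

open Matrix Finset Polynomial
open scoped BigOperators

variable {m K : ℕ}

/-! ## Bilinear bookkeeping -/

/-- For symmetric `M`: `yᵀ M x = xᵀ M y`. [folklore] -/
theorem dotProduct_mulVec_symm {M : Matrix (Fin m) (Fin m) ℝ} (hM : M.IsSymm) (x y : Fin m → ℝ) :
    y ⬝ᵥ (M *ᵥ x) = x ⬝ᵥ (M *ᵥ y) := by
  rw [Matrix.dotProduct_mulVec, ← Matrix.mulVec_transpose, hM.eq, dotProduct_comm]

/-- Expansion of the quadratic form at `α • x + β • y`. [folklore] -/
theorem quadForm_lincomb (M : Matrix (Fin m) (Fin m) ℝ) (x y : Fin m → ℝ) (α β : ℝ) :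
    (α • x + β • y) ⬝ᵥ (M *ᵥ (α • x + β • y))
      = α ^ 2 * (x ⬝ᵥ (M *ᵥ x)) + α * β * (x ⬝ᵥ (M *ᵥ y)) + α * β * (y ⬝ᵥ (M *ᵥ x))
          + β ^ 2 * (y ⬝ᵥ (M *ᵥ y)) := by
  simp only [Matrix.mulVec_add, Matrix.mulVec_smul, dotProduct_add, add_dotProduct, dotProduct_smul, smul_dotProduct,
    smul_eq_mul]
  ring

/-- The rank-one certificate form: `xᵀ (W Wᵀ) y = (Wᵀx)₀ (Wᵀy)₀` for a single column `W`. [folklore] -/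
theorem dotProduct_col_mul_transpose (W : Matrix (Fin m) (Fin 1) ℝ) (x y : Fin m → ℝ) :
    x ⬝ᵥ ((W * Wᵀ) *ᵥ y) = (Wᵀ *ᵥ x) 0 * (Wᵀ *ᵥ y) 0 := by
  rw [← Matrix.mulVec_mulVec, Matrix.dotProduct_mulVec, ← Matrix.mulVec_transpose]
  simp [dotProduct]

/-! ## The index-one reverse Cauchy–Schwarz inequality -/

/-- **Two `J`-negative vectors are never `J`-orthogonal** (pivot index one): if `J` is symmetric, `J + W Wᵀ ⪰ 0` for a single
column `W`, and `xᵀJx < 0`, then `(xᵀJx)(yᵀJy) ≤ (xᵀJy)²` for every `y` (trivial if `yᵀJy ≥ 0`). [folklore] -/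
theorem indexOne_pairing_sq_ge {J : Matrix (Fin m) (Fin m) ℝ} (hJ : J.IsSymm) (W : Matrix (Fin m) (Fin 1) ℝ)
    (hW : (J + W * Wᵀ).PosSemidef) (x y : Fin m → ℝ) (hx : x ⬝ᵥ (J *ᵥ x) < 0) :
    (x ⬝ᵥ (J *ᵥ x)) * (y ⬝ᵥ (J *ᵥ y)) ≤ (x ⬝ᵥ (J *ᵥ y)) ^ 2 := by
  set a := x ⬝ᵥ (J *ᵥ x) with ha
  set b := x ⬝ᵥ (J *ᵥ y) with hb
  set c := y ⬝ᵥ (J *ᵥ y) with hc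
  set p := (Wᵀ *ᵥ x) 0 with hp
  set q := (Wᵀ *ᵥ y) 0 with hq
  have hyx : y ⬝ᵥ (J *ᵥ x) = b := dotProduct_mulVec_symm hJ x y
  -- the certificate at `x`: `a + p² ≥ 0`, so `p ≠ 0`
  have hPx : 0 ≤ a + p ^ 2 := by
    have h := hW.dotProduct_mulVec_nonneg x
    rw [star_trivial, Matrix.add_mulVec, dotProduct_add, dotProduct_col_mul_transpose] at h
    nlinarith [h]
  have hp0 : 0 < p ^ 2 := by nlinarith
  -- the certificate at `z = q • x − p • y`, where the rank-one part vanishes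
  have hz : 0 ≤ q ^ 2 * a - 2 * p * q * b + p ^ 2 * c := by
    have h := hW.dotProduct_mulVec_nonneg (q • x + (-p) • y)
    rw [star_trivial, Matrix.add_mulVec, dotProduct_add, quadForm_lincomb, hyx, dotProduct_col_mul_transpose] at h
    have hW0 : (Wᵀ *ᵥ (q • x + (-p) • y)) 0 = 0 := by
      rw [Matrix.mulVec_add, Matrix.mulVec_smul, Matrix.mulVec_smul]
      simp only [Pi.add_apply, Pi.smul_apply, smul_eq_mul]
      rw [← hp, ← hq]; ring
    rw [hW0, mul_zero, add_zero] at h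
    nlinarith [h]
  -- if `b² < a c` the binary form `[[a, b], [b, c]]` is negative definite, contradicting `hz`
  by_contra hlt
  push Not at hlt
  have key : a * (q ^ 2 * a - 2 * p * q * b + p ^ 2 * c) = (a * q - b * p) ^ 2 + (a * c - b ^ 2) * p ^ 2 := by ring
  have hpos : 0 < (a * q - b * p) ^ 2 + (a * c - b ^ 2) * p ^ 2 := by
    nlinarith [sq_nonneg (a * q - b * p), mul_pos (sub_pos.2 hlt) hp0]
  nlinarith [mul_nonneg_of_nonpos_of_nonpos hx.le (le_refl 0), key, hpos, hz, hx]

/-! ## PSD at every crossing, and uniqueness of the crossing parameter -/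

/-- A kernel vector of `A + λJ` (`A ⪰ 0`, `lam > 0`, `det J ≠ 0`) is strictly `J`-negative. [folklore] -/
theorem kernel_quadForm_neg {A J : Matrix (Fin m) (Fin m) ℝ} (hA : A.PosSemidef) (hJdet : J.det ≠ 0) {lam : ℝ} (hlam : 0 < lam)
    {v : Fin m → ℝ} (hv0 : v ≠ 0) (hv : (A + lam • J) *ᵥ v = 0) : v ⬝ᵥ (J *ᵥ v) < 0 := by
  have hAv : 0 ≤ v ⬝ᵥ (A *ᵥ v) := by simpa only [star_trivial] using hA.dotProduct_mulVec_nonneg v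
  have hsum : v ⬝ᵥ (A *ᵥ v) + lam * (v ⬝ᵥ (J *ᵥ v)) = 0 := by
    have h := congrArg (fun w => v ⬝ᵥ w) hv
    simp only [Matrix.add_mulVec, Matrix.smul_mulVec, dotProduct_add, dotProduct_smul, smul_eq_mul,
      dotProduct_zero] at h
    exact h
  rcases lt_or_ge (v ⬝ᵥ (J *ᵥ v)) 0 with h | h
  · exact h
  · exfalso
    have hJ0 : v ⬝ᵥ (J *ᵥ v) = 0 := by nlinarith [mul_nonneg hlam.le h]
    have hA0 : v ⬝ᵥ (A *ᵥ v) = 0 := by rw [hJ0, mul_zero, add_zero] at hsum; exact hsum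
    have hAv0 : A *ᵥ v = 0 := (hA.dotProduct_mulVec_zero_iff v).1 (by rw [star_trivial]; exact hA0)
    have hJv : J *ᵥ v = 0 := by
      have h2 := hv
      rw [Matrix.add_mulVec, hAv0, zero_add, Matrix.smul_mulVec] at h2
      exact (smul_eq_zero.1 h2).resolve_left hlam.ne'
    exact hJdet (Matrix.exists_mulVec_eq_zero_iff.1 ⟨v, hv0, hJv⟩)

/-- **PSD AT EVERY CROSSING** (index one, every `m`).  Let `A ⪰ 0`, `J` symmetric with `det J ≠ 0` and `J + W Wᵀ ⪰ 0` for a single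
column `W`, and `lam > 0` with `det (A + lam J) = 0`.  Then `A + lam J ⪰ 0`. [folklore] -/
theorem posSemidef_of_det_eq_zero {A J : Matrix (Fin m) (Fin m) ℝ} (hA : A.PosSemidef) (hJ : J.IsSymm) (hJdet : J.det ≠ 0)
    (W : Matrix (Fin m) (Fin 1) ℝ) (hW : (J + W * Wᵀ).PosSemidef) {lam : ℝ} (hlam : 0 < lam) (hroot : (A + lam • J).det = 0) :
    (A + lam • J).PosSemidef := by
  obtain ⟨v, hv0, hv⟩ := Matrix.exists_mulVec_eq_zero_iff.2 hroot
  have hAs : A.IsSymm := Matrix.isHermitian_iff_isSymm.1 hA.1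
  have hQs : (A + lam • J).IsSymm := by
    unfold Matrix.IsSymm at hAs hJ ⊢
    rw [Matrix.transpose_add, Matrix.transpose_smul, hAs, hJ]
  have hvJ : v ⬝ᵥ (J *ᵥ v) < 0 := kernel_quadForm_neg hA hJdet hlam hv0 hv
  refine Matrix.PosSemidef.of_dotProduct_mulVec_nonneg (Matrix.isHermitian_iff_isSymm.2 hQs) fun x => ?_
  rw [star_trivial]
  by_contra hx
  push Not at hx
  have hax0 : 0 ≤ x ⬝ᵥ (A *ᵥ x) := by simpa only [star_trivial] using hA.dotProduct_mulVec_nonneg x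
  have hQx : x ⬝ᵥ ((A + lam • J) *ᵥ x) = x ⬝ᵥ (A *ᵥ x) + lam * (x ⬝ᵥ (J *ᵥ x)) := by
    simp only [Matrix.add_mulVec, Matrix.smul_mulVec, dotProduct_add, dotProduct_smul, smul_eq_mul]
  rw [hQx] at hx
  have hjx0 : x ⬝ᵥ (J *ᵥ x) < 0 := by nlinarith
  -- index one: `(vᵀJv)(xᵀJx) ≤ (vᵀJx)²`
  have hrc := indexOne_pairing_sq_ge hJ W hW v x hvJ
  -- `A ⪰ 0` at `α • v + β • x`, with `A = (A + lam J) − lam J` and `(A + lam J) v = 0`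
  have hxQv : x ⬝ᵥ ((A + lam • J) *ᵥ v) = 0 := by rw [hv, dotProduct_zero]
  have hvQx : v ⬝ᵥ ((A + lam • J) *ᵥ x) = 0 := by rw [dotProduct_mulVec_symm hQs x v]; exact hxQv
  have hvQv : v ⬝ᵥ ((A + lam • J) *ᵥ v) = 0 := by rw [hv, dotProduct_zero]
  have hxJv : x ⬝ᵥ (J *ᵥ v) = v ⬝ᵥ (J *ᵥ x) := dotProduct_mulVec_symm hJ v x
  have hI : ∀ α β : ℝ, 0 ≤ β ^ 2 * (x ⬝ᵥ (A *ᵥ x)) - 2 * lam * α * β * (v ⬝ᵥ (J *ᵥ x))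
      - lam * α ^ 2 * (v ⬝ᵥ (J *ᵥ v)) := by
    intro α β
    have h := hA.dotProduct_mulVec_nonneg (α • v + β • x)
    rw [star_trivial] at h
    have hsplit : (α • v + β • x) ⬝ᵥ (A *ᵥ (α • v + β • x))
        = (α • v + β • x) ⬝ᵥ ((A + lam • J) *ᵥ (α • v + β • x))
          - lam * ((α • v + β • x) ⬝ᵥ (J *ᵥ (α • v + β • x))) := by
      simp only [Matrix.add_mulVec, Matrix.smul_mulVec, dotProduct_add, dotProduct_smul, smul_eq_mul]; ring
    rw [hsplit, quadForm_lincomb, quadForm_lincomb, hvQv, hvQx, hxQv, hQx, hxJv] at h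
    nlinarith [h]
  -- consequence: `lam (vᵀJx)² ≤ −(vᵀJv)(xᵀAx)`
  have hII : lam * (v ⬝ᵥ (J *ᵥ x)) ^ 2 ≤ -(v ⬝ᵥ (J *ᵥ v)) * (x ⬝ᵥ (A *ᵥ x)) := by
    rcases hax0.eq_or_lt with hax00 | haxpos
    · -- `xᵀAx = 0`: `hI` at `(α, β) = (vᵀJx, −vᵀJv)` forces `vᵀJx = 0`, contradicting the reverse Cauchy–Schwarz
      exfalso
      have h1 := hI (v ⬝ᵥ (J *ᵥ x)) (-(v ⬝ᵥ (J *ᵥ v)))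
      rw [← hax00] at h1
      have hsq : (v ⬝ᵥ (J *ᵥ x)) ^ 2 ≤ 0 := by
        have e1 : (-(v ⬝ᵥ (J *ᵥ v))) ^ 2 * 0 - 2 * lam * (v ⬝ᵥ (J *ᵥ x)) * -(v ⬝ᵥ (J *ᵥ v)) * (v ⬝ᵥ (J *ᵥ x))
            - lam * (v ⬝ᵥ (J *ᵥ x)) ^ 2 * (v ⬝ᵥ (J *ᵥ v)) = lam * (v ⬝ᵥ (J *ᵥ v)) * (v ⬝ᵥ (J *ᵥ x)) ^ 2 := by
          ring
        rw [e1] at h1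
        nlinarith [mul_pos hlam (neg_pos.2 hvJ), sq_nonneg (v ⬝ᵥ (J *ᵥ x))]
      have hjvx0 : v ⬝ᵥ (J *ᵥ x) = 0 := by nlinarith [sq_nonneg (v ⬝ᵥ (J *ᵥ x))]
      rw [hjvx0] at hrc
      nlinarith [mul_pos (neg_pos.2 hvJ) (neg_pos.2 hjx0)]
    · have h := hI (x ⬝ᵥ (A *ᵥ x)) (lam * (v ⬝ᵥ (J *ᵥ x)))
      have e2 : (lam * (v ⬝ᵥ (J *ᵥ x))) ^ 2 * (x ⬝ᵥ (A *ᵥ x))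
            - 2 * lam * (x ⬝ᵥ (A *ᵥ x)) * (lam * (v ⬝ᵥ (J *ᵥ x))) * (v ⬝ᵥ (J *ᵥ x))
            - lam * (x ⬝ᵥ (A *ᵥ x)) ^ 2 * (v ⬝ᵥ (J *ᵥ v))
          = -(lam * (x ⬝ᵥ (A *ᵥ x))) * (lam * (v ⬝ᵥ (J *ᵥ x)) ^ 2 + (x ⬝ᵥ (A *ᵥ x)) * (v ⬝ᵥ (J *ᵥ v))) := by
        ring
      rw [e2] at h
      have hprod : 0 < lam * (x ⬝ᵥ (A *ᵥ x)) := mul_pos hlam haxpos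
      have hle : lam * (v ⬝ᵥ (J *ᵥ x)) ^ 2 + (x ⬝ᵥ (A *ᵥ x)) * (v ⬝ᵥ (J *ᵥ v)) ≤ 0 := by
        by_contra hgt
        push Not at hgt
        nlinarith [mul_pos hprod hgt]
      linarith
  -- combine: `lam (vᵀJv)(xᵀJx) ≤ lam (vᵀJx)² ≤ −(vᵀJv)(xᵀAx)`, and `−vᵀJv > 0`
  have h3 : lam * ((v ⬝ᵥ (J *ᵥ v)) * (x ⬝ᵥ (J *ᵥ x))) ≤ -(v ⬝ᵥ (J *ᵥ v)) * (x ⬝ᵥ (A *ᵥ x)) :=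
    (mul_le_mul_of_nonneg_left hrc hlam.le).trans hII
  have h4 : 0 < -(v ⬝ᵥ (J *ᵥ v)) * -(x ⬝ᵥ (A *ᵥ x) + lam * (x ⬝ᵥ (J *ᵥ x))) :=
    mul_pos (neg_pos.2 hvJ) (neg_pos.2 hx)
  nlinarith [h3, h4]

/-- **UNIQUENESS OF THE CROSSING PARAMETER** (index one, every `m`): with `A, J, W` as above, if `det (A + lam₁J) = det (A + lam₂J) = 0`
for `lam₁, lam₂ > 0` then `lam₁ = lam₂`. [folklore] -/
theorem crossing_unique {A J : Matrix (Fin m) (Fin m) ℝ} (hA : A.PosSemidef) (hJ : J.IsSymm) (hJdet : J.det ≠ 0)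
    (W : Matrix (Fin m) (Fin 1) ℝ) (hW : (J + W * Wᵀ).PosSemidef) {lam₁ lam₂ : ℝ} (h₁ : 0 < lam₁) (h₂ : 0 < lam₂)
    (hroot₁ : (A + lam₁ • J).det = 0) (hroot₂ : (A + lam₂ • J).det = 0) : lam₁ = lam₂ := by
  by_contra hne
  -- a kernel vector at the smaller parameter is `J`-negative; PSD at the larger parameter fails on it
  have key : ∀ {μ ν : ℝ}, 0 < μ → μ < ν → (A + μ • J).det = 0 → (A + ν • J).det = 0 → False := by
    intro μ ν hμ hμν hrμ hrν
    obtain ⟨v, hv0, hv⟩ := Matrix.exists_mulVec_eq_zero_iff.2 hrμ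
    have hvJ := kernel_quadForm_neg hA hJdet hμ hv0 hv
    have hPSD := posSemidef_of_det_eq_zero hA hJ hJdet W hW (hμ.trans hμν) hrν
    have h := hPSD.dotProduct_mulVec_nonneg v
    rw [star_trivial] at h
    have hsplit : v ⬝ᵥ ((A + ν • J) *ᵥ v) = v ⬝ᵥ ((A + μ • J) *ᵥ v) + (ν - μ) * (v ⬝ᵥ (J *ᵥ v)) := by
      simp only [Matrix.add_mulVec, Matrix.smul_mulVec, dotProduct_add, dotProduct_smul, smul_eq_mul]; ring
    rw [hsplit, hv, dotProduct_zero, zero_add] at h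
    nlinarith [mul_pos (sub_pos.2 hμν) (neg_pos.2 hvJ)]
  rcases lt_or_gt_of_ne hne with hlt | hgt
  · exact key h₁ hlt hroot₁ hroot₂
  · exact key h₂ hgt hroot₂ hroot₁

/-! ## The pencil: every positive root is a PSD root; the envelope bound -/

/-- A non-negative combination of PSD letters is PSD (every size). [folklore] -/
theorem posSemidef_sum_pow_smul (d : Fin K → ℕ) (P : Fin K → Matrix (Fin m) (Fin m) ℝ)
    (hP : ∀ k, (P k).PosSemidef) {u : ℝ} (hu : 0 ≤ u) : (∑ k, u ^ d k • P k).PosSemidef := by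
  classical
  induction (Finset.univ : Finset (Fin K)) using Finset.induction_on with
  | empty => simpa using Matrix.PosSemidef.zero
  | insert a s ha ih =>
    rw [Finset.sum_insert ha]
    exact ((hP a).smul (pow_nonneg hu _)).add ih

/-- **EVERY POSITIVE ROOT IS A PSD ROOT** (index one, non-degenerate pivot, every size `m`): for `u > 0` with
`det (u^e J + ∑ u^{dₖ} Pₖ) = 0`, the matrix `u^e J + ∑ u^{dₖ} Pₖ` is positive semidefinite. [folklore] -/
theorem posSemidef_at_posRoot (e : ℕ) (d : Fin K → ℕ) (J : Matrix (Fin m) (Fin m) ℝ) (P : Fin K → Matrix (Fin m) (Fin m) ℝ)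
    (hJ : J.IsSymm) (hJdet : J.det ≠ 0) (W : Matrix (Fin m) (Fin 1) ℝ) (hW : (J + W * Wᵀ).PosSemidef)
    (hP : ∀ k, (P k).PosSemidef) {u : ℝ} (hu : 0 < u)
    (hroot : (Matrix.det (((X : ℝ[X]) ^ e) • J.map Polynomial.C
        + ∑ k, ((X : ℝ[X]) ^ d k) • (P k).map Polynomial.C)).eval u = 0) :
    (u ^ e • J + ∑ k, u ^ d k • P k).PosSemidef := by
  rw [eval_det_pivot] at hroot
  rw [add_comm] at hroot ⊢
  exact posSemidef_of_det_eq_zero (posSemidef_sum_pow_smul d P hP hu.le) hJ hJdet W hW (pow_pos hu e) hroot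

/-- **UNIQUE CROSSING FOR THE PENCIL**: for `u > 0` there is at most one `lam > 0` with `det (lam J + ∑ u^{dₖ} Pₖ) = 0`; in particular
`u` is a root iff that `lam` exists and equals `u^e`. [folklore] -/
theorem crossing_unique_pencil (d : Fin K → ℕ) (J : Matrix (Fin m) (Fin m) ℝ) (P : Fin K → Matrix (Fin m) (Fin m) ℝ)
    (hJ : J.IsSymm) (hJdet : J.det ≠ 0) (W : Matrix (Fin m) (Fin 1) ℝ) (hW : (J + W * Wᵀ).PosSemidef)
    (hP : ∀ k, (P k).PosSemidef) {u : ℝ} (hu : 0 < u) {lam₁ lam₂ : ℝ} (h₁ : 0 < lam₁) (h₂ : 0 < lam₂)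
    (hroot₁ : (lam₁ • J + ∑ k, u ^ d k • P k).det = 0) (hroot₂ : (lam₂ • J + ∑ k, u ^ d k • P k).det = 0) : lam₁ = lam₂ := by
  rw [add_comm] at hroot₁ hroot₂
  exact crossing_unique (posSemidef_sum_pow_smul d P hP hu.le) hJ hJdet W hW h₁ h₂ hroot₁ hroot₂

/-- **THE ENVELOPE BOUND** (every `m`): at a positive root `u`, for every vector `x`,
`u^e · (−xᵀJx) ≤ ∑ₖ u^{dₖ} · xᵀPₖx` — `u^e` lies below every member of the family of `K`-nomials with non-negative coefficients
`xᵀPₖx` (normalised by `−xᵀJx > 0` on the `J`-negative vectors). [folklore] -/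
theorem pow_mul_le_quadForm_of_isRoot (e : ℕ) (d : Fin K → ℕ) (J : Matrix (Fin m) (Fin m) ℝ)
    (P : Fin K → Matrix (Fin m) (Fin m) ℝ) (hJ : J.IsSymm) (hJdet : J.det ≠ 0) (W : Matrix (Fin m) (Fin 1) ℝ)
    (hW : (J + W * Wᵀ).PosSemidef) (hP : ∀ k, (P k).PosSemidef) {u : ℝ} (hu : 0 < u)
    (hroot : (Matrix.det (((X : ℝ[X]) ^ e) • J.map Polynomial.C
        + ∑ k, ((X : ℝ[X]) ^ d k) • (P k).map Polynomial.C)).eval u = 0) (x : Fin m → ℝ) :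
    u ^ e * (-(x ⬝ᵥ (J *ᵥ x))) ≤ ∑ k, u ^ d k * (x ⬝ᵥ (P k *ᵥ x)) := by
  have h := (posSemidef_at_posRoot e d J P hJ hJdet W hW hP hu hroot).dotProduct_mulVec_nonneg x
  rw [star_trivial, Convexity.quadForm_eval_pencil] at h
  linarith

end Summit.ValiantsHypothesis.ValiantsHypothesis.Theorems.LacunarySymmetroidMatrixDescartes.Pivot.IndexOneRoots
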